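import Mathlib.Tactic.Linarith
import Mathlib.Tactic.Positivity
import Mathlib.Tactic.Ring
import Mathlib.Tactic.FieldSimp
import Mathlib.Data.Real.Basic

/-!
# `PolycrystalWulffBound`: the BAND LEMMA of the paired Knothe calibration for the twin-hexagon
# inequality (crux `stmt-Ventures-19482` / `23911`; memo P-THI-g17 §4; lane poly-p2 gen 17)

Route `StickyWulffConstant` of the venture `Summits/Ventures/Crystal3D`.  Memo P-THI-g17 proves the 2D
TWIN-HEXAGON INEQUALITY `THI(P,Q;κ)` for every `κ ≥ δ := Q − P` (sharp) by a PAIRED KNOTHE CALIBRATION on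
the six vertex sectors of the hexagon `H(P,Q)`: outside a middle band the two Knothe maps (onto the sector
of `H` and onto the sector of `−H`) differ by a translation of length `δ`; inside the band the interface
bound `|T − T*| ≤ δ` is the following elementary statement about the «equal-mass coupling» `y ↦ w` of the
band `[−δ, δ/2]` (normalised here to `δ = 1`; `C = 4P/δ ≥ 4`):

* the coupling curve is `C·(y + w + ½) = (y² + w² + 1)/… `, which in the region `R1 = {y ≤ 0 ≤ w}` reads
  `C (y + w + ½) = 4w² − 2y² + 1` and in `R2 = {y, w ≤ 0}` reads `C (y + w + ½) = 1 − 2y² − 2w²`;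
* the two squared end-displacements are `D_r = (y+w)² + (y−w)²/3` and `D_l = (y+w)² + 3(|w| − |y|)²`;
* CLAIM: `D_r ≤ 1` and `D_l ≤ 1` on the band.

This file certifies the algebra of the two regions (the third region is the mirror image of `R1`):
`knotheBand_smallRoot_le` (in `R1`, with `σ := y + w + ½` and `ε := 1 + y ≥ 0`, the coupling is the SMALL root
of `4σ² − σ(C − 4 + 8ε) + 2ε² = 0`, whence `σ ≤ ε/2`), `knotheBand_R1` (`D_l, D_r ≤ 1` in `R1`),
`knotheBand_root_window` (the entry point `y₀` of `R2`, i.e. the root of `2y₀² + C y₀ + C/2 − 1 = 0` in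
`[−½, 0]`, satisfies `2C y₀ + C − 1 = 4t(1−t) ≥ 0` with `t = y₀ + ½`), and `knotheBand_R2` (`D_l ≤ 1`,
hence `D_r ≤ 1`, on the `R2` arc).  Pure real algebra; no geometry, no measure theory.
WHAT THIS IS NOT: the twin-hexagon inequality itself (2D GMT, paper), nor the identification of the
coupling with these curves (paper, memo §4 (T1)–(T3)); the crux is not claimed.
-/

namespace Summit.Ventures.Crystal3D.Theorems

/-- **Small root.**  In region `R1` the normalised coupling offset `σ = y + w + ½` and `ε = 1 + y ∈ [0,1]`
satisfy `4σ² − σ(C − 4 + 8ε) + 2ε² = 0`; on the branch through `σ(0) = 0` (the smaller root, i.e.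
`8σ ≤ C − 4 + 8ε`) one has `σ ≤ ε/2` provided `C ≥ 4`. -/
theorem knotheBand_smallRoot_le (C ε σ : ℝ) (hC : 4 ≤ C) (hε : 0 ≤ ε) (hσ : 0 ≤ σ)
    (hsmall : 8 * σ ≤ C - 4 + 8 * ε)
    (hroot : 4 * σ ^ 2 - σ * (C - 4 + 8 * ε) + 2 * ε ^ 2 = 0) : 2 * σ ≤ ε := by
  -- σ · (B − 4σ) = 2ε² with B − 4σ ≥ 4ε and B − 4σ ≥ 4σ, where B = C − 4 + 8ε
  have hprod : σ * ((C - 4 + 8 * ε) - 4 * σ) = 2 * ε ^ 2 := by nlinarith [hroot]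
  have hfac : 4 * ε ≤ (C - 4 + 8 * ε) - 4 * σ := by linarith
  have hfac' : 4 * σ ≤ (C - 4 + 8 * ε) - 4 * σ := by linarith
  have hkey : σ * (4 * ε) ≤ 2 * ε ^ 2 := by
    calc σ * (4 * ε) ≤ σ * ((C - 4 + 8 * ε) - 4 * σ) := mul_le_mul_of_nonneg_left hfac hσ
      _ = 2 * ε ^ 2 := hprod
  rcases eq_or_lt_of_le hε with h0 | hpos
  · -- ε = 0: then σ (B − 4σ) = 0 with B − 4σ ≥ 4σ, forcing σ = 0
    subst h0
    by_contra h
    have hσpos : 0 < σ := by linarith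
    have : 0 < σ * ((C - 4 + 8 * 0) - 4 * σ) := mul_pos hσpos (by linarith)
    linarith [hprod]
  · -- ε > 0: divide σ·4ε ≤ 2ε² by 2ε
    by_contra h
    have h' : ε < 2 * σ := lt_of_not_ge h
    have : 2 * ε ^ 2 < σ * (4 * ε) := by nlinarith [h', hpos]
    linarith [hkey]

/-- **Region R1** (`y ≤ 0 ≤ w`, band coordinates normalised to `δ = 1`, `y ≥ −1`): on the small-root
branch of the coupling curve `C (y + w + ½) = 4w² − 2y² + 1` both squared end-displacements are at most
`1`: `D_l = (y+w)² + 3(w + y)² ≤ 1` and `D_r = (y+w)² + (y−w)²/3 ≤ 1` (`C ≥ 4`). -/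
theorem knotheBand_R1 (C y w : ℝ) (hC : 4 ≤ C) (hy : -1 ≤ y) (hy0 : y ≤ 0) (hw : 0 ≤ w)
    (hcurve : C * (y + w + 1 / 2) = 4 * w ^ 2 - 2 * y ^ 2 + 1)
    (hsmall : 8 * (y + w + 1 / 2) ≤ C - 4 + 8 * (1 + y)) :
    (y + w) ^ 2 + 3 * (w + y) ^ 2 ≤ 1 ∧ (y + w) ^ 2 + (y - w) ^ 2 / 3 ≤ 1 := by
  -- σ := y + w + ½, ε := 1 + y ∈ [0, 1]
  have hε : 0 ≤ 1 + y := by linarith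
  have hε1 : 1 + y ≤ 1 := by linarith
  -- the curve in (σ, ε) form
  have hroot : 4 * (y + w + 1 / 2) ^ 2 - (y + w + 1 / 2) * (C - 4 + 8 * (1 + y))
      + 2 * (1 + y) ^ 2 = 0 := by
    nlinarith [hcurve]
  -- σ ≥ 0: for σ < 0 the quadratic is > 0 (B ≥ 0)
  have hB : 0 ≤ C - 4 + 8 * (1 + y) := by linarith
  have hσ0 : 0 ≤ y + w + 1 / 2 := by
    by_contra h
    have h' : y + w + 1 / 2 < 0 := lt_of_not_ge h
    have : 0 < 4 * (y + w + 1 / 2) ^ 2 - (y + w + 1 / 2) * (C - 4 + 8 * (1 + y))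
        + 2 * (1 + y) ^ 2 := by
      have h1 : 0 < 4 * (y + w + 1 / 2) ^ 2 := by nlinarith [h']
      have h2 : 0 ≤ -(y + w + 1 / 2) * (C - 4 + 8 * (1 + y)) :=
        mul_nonneg (by linarith) hB
      have h3 : 0 ≤ 2 * (1 + y) ^ 2 := by positivity
      linarith
    linarith
  have h2σ : 2 * (y + w + 1 / 2) ≤ 1 + y :=
    knotheBand_smallRoot_le C (1 + y) (y + w + 1 / 2) hC hε hσ0 hsmall hroot
  refine ⟨?_, ?_⟩
  · -- D_l = 4 (σ − ½)² = 1 + 4 σ (σ − 1) ≤ 1 since 0 ≤ σ ≤ 1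
    have h1 : (y + w) ^ 2 + 3 * (w + y) ^ 2
        = 1 + 4 * ((y + w + 1 / 2) * ((y + w + 1 / 2) - 1)) := by ring
    have h2 : (y + w + 1 / 2) * ((y + w + 1 / 2) - 1) ≤ 0 :=
      mul_nonpos_of_nonneg_of_nonpos hσ0 (by linarith)
    linarith [h1, h2]
  · -- D_r − 1 = (4/3)(σ² − εσ + ε²) − 2ε ≤ (4/3)ε² − 2ε ≤ 0
    have h1 : (y + w) ^ 2 + (y - w) ^ 2 / 3 - 1
        = (4 / 3) * ((y + w + 1 / 2) * ((y + w + 1 / 2) - (1 + y))) + ((4 / 3) * (1 + y) ^ 2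
          - 2 * (1 + y)) := by ring
    have h2 : (y + w + 1 / 2) * ((y + w + 1 / 2) - (1 + y)) ≤ 0 :=
      mul_nonpos_of_nonneg_of_nonpos hσ0 (by linarith)
    have h3 : (4 / 3) * (1 + y) ^ 2 - 2 * (1 + y) ≤ 0 := by nlinarith [hε, hε1]
    linarith [h1, h2, h3]

/-- **The entry point of region R2.**  The root `y₀ ∈ [−½, 0]` of `2y₀² + C y₀ + C/2 − 1 = 0` satisfies
`2C y₀ + C − 1 ≥ 0` (indeed `= 4t(1−t)` with `t = y₀ + ½ ∈ [0,1]`), for `C ≥ 2`. -/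
theorem knotheBand_root_window (C y₀ : ℝ) (hC : 2 ≤ C) (hroot : 2 * y₀ ^ 2 + C * y₀ + C / 2 - 1 = 0)
    (hlo : -1 / 2 ≤ y₀) : 0 ≤ 2 * C * y₀ + C - 1 := by
  set t := y₀ + 1 / 2 with ht
  have ht0 : 0 ≤ t := by linarith
  have hy : y₀ = t - 1 / 2 := by rw [ht]; ring
  have hrel : 2 * t ^ 2 + (C - 2) * t = 1 / 2 := by
    rw [hy] at hroot; linarith [hroot, show 2 * (t - 1 / 2) ^ 2 + C * (t - 1 / 2) + C / 2 - 1
      = 2 * t ^ 2 + (C - 2) * t - 1 / 2 by ring]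
  have ht1 : t ≤ 1 := by nlinarith [ht0, hrel]
  have hid : 2 * C * y₀ + C - 1 = 4 * t * (1 - t) := by
    rw [hy]; nlinarith [hrel]
  rw [hid]
  have : 0 ≤ 1 - t := by linarith
  positivity

/-- **Region R2** (`y, w ≤ 0`): on the arc `C (y + w + ½) = 1 − 2y² − 2w²` with `y, w ∈ [y₀, 0]`, where
`y₀ ∈ [−½, 0]` is the root of `2y₀² + C y₀ + C/2 − 1 = 0` (the hypothesis `w ≤ 0` is not needed), the larger squared end-displacement
`D_l = (y+w)² + 3(y−w)²` is at most `1` (hence so is `D_r = (y+w)² + (y−w)²/3`), for `C ≥ 4`. -/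
theorem knotheBand_R2 (C y₀ y w : ℝ) (hC : 4 ≤ C)
    (hroot : 2 * y₀ ^ 2 + C * y₀ + C / 2 - 1 = 0) (hlo : -1 / 2 ≤ y₀)
    (hy : y₀ ≤ y) (hy0 : y ≤ 0) (hw : y₀ ≤ w)
    (hcirc : C * (y + w + 1 / 2) = 1 - 2 * y ^ 2 - 2 * w ^ 2) :
    (y + w) ^ 2 + 3 * (y - w) ^ 2 ≤ 1 ∧ (y + w) ^ 2 + (y - w) ^ 2 / 3 ≤ 1 := by
  have hy₀0 : y₀ ≤ 0 := le_trans hy hy0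
  -- p := y + w, q := y − w; the circle gives q² = 1 − p² − C p − C/2
  have hq : (y - w) ^ 2 = 1 - (y + w) ^ 2 - C * (y + w) - C / 2 := by nlinarith [hcirc]
  -- |q| ≤ p − 2 y₀
  have hqabs : (y - w) ^ 2 ≤ ((y + w) - 2 * y₀) ^ 2 := by
    nlinarith [mul_nonneg (sub_nonneg.mpr hy) (sub_nonneg.mpr hw)]
  -- hence (p − y₀)(2(p − y₀) + C) ≥ 0, and 2(p − y₀) + C > 0, so p ≥ y₀
  have hfac : 0 ≤ ((y + w) - y₀) * (2 * ((y + w) - y₀) + C) := by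
    nlinarith [hq, hqabs, hroot]
  have hpos : 0 < 2 * ((y + w) - y₀) + C := by nlinarith [hy, hw, hlo, hC]
  have hp : y₀ ≤ y + w := by
    by_contra h
    have h' : y + w < y₀ := lt_of_not_ge h
    have : ((y + w) - y₀) * (2 * ((y + w) - y₀) + C) < 0 :=
      mul_neg_of_neg_of_pos (by linarith) hpos
    linarith
  -- f(p) := 2p² + 3Cp + 3C/2 − 2 is increasing on [y₀, 0] and f(y₀) = 2C y₀ + C − 1 ≥ 0
  have hfy₀ : 0 ≤ 2 * C * y₀ + C - 1 := knotheBand_root_window C y₀ (by linarith) hroot hlo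
  have hf : 0 ≤ 2 * (y + w) ^ 2 + 3 * C * (y + w) + 3 * C / 2 - 2 := by
    have hmono : 2 * (y + w) ^ 2 + 3 * C * (y + w) + 3 * C / 2 - 2
        - (2 * y₀ ^ 2 + 3 * C * y₀ + 3 * C / 2 - 2)
        = ((y + w) - y₀) * (2 * ((y + w) + y₀) + 3 * C) := by ring
    have hge : 0 ≤ ((y + w) - y₀) * (2 * ((y + w) + y₀) + 3 * C) :=
      mul_nonneg (sub_nonneg.mpr hp) (by nlinarith [hp, hlo, hC, hy₀0])
    have hval : 2 * y₀ ^ 2 + 3 * C * y₀ + 3 * C / 2 - 2 = 2 * C * y₀ + C - 1 := by linarith [hroot]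
    linarith [hmono, hge, hval, hfy₀]
  have hDl : (y + w) ^ 2 + 3 * (y - w) ^ 2 ≤ 1 := by nlinarith [hq, hf]
  refine ⟨hDl, ?_⟩
  nlinarith [hDl, sq_nonneg (y - w)]

end Summit.Ventures.Crystal3D.Theorems
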